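import Literature.Uncategorized.GammaLowerBound
import Literature.Analysis.SpecialFunctions.GammaVerticalLowerBound
import HarnessLib

/-!
# Discharge of `Literature.Uncategorized.GammaLowerBound` — MOVED (one-line consequences)

The mathematics formerly proved here (the explicit lower bound
`|Γ(1/2 + n + iy)| ≥ √π · e^{-π|y|/2} · 2^{-n}`) now lives at its topical home
`Literature/Analysis/SpecialFunctions/GammaVerticalLowerBound.lean` as the theorem
`Literature.Analysis.SpecialFunctions.GammaVert.norm_Gamma_half_add_nat_add_mul_I_ge`
(librarian refactor wi-35549, 2026-08-17). This module keeps, with unchanged names and statements,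

* `GammaLowerBound_holds : GammaLowerBound` — the discharge record of the named fact
  `Literature.Uncategorized.GammaLowerBound` (still the hypothesis type consumed by
  `Summits/RiemannHypothesis/…/SpectralTraceWindowTracePrime2Stub*.lean` and registered stub
  `stub_gammaLower` of `SpectralTraceHeckeSurrogateDefs.lean`), now one line;
* `norm_Gamma_half_add_mul_I_ge` — the `n = 0` case, deprecated in favour of the theorem above.

Importers need no change. References: E. C. Titchmarsh, *The theory of the Riemann zeta-function*
(1986), §4.42; the bound itself is elementary.
-/

noncomputable section

namespace Literature.Uncategorized

open Complex

/-- On the line `Re z = 1/2`: `|Γ(1/2 + iy)| ≥ √π e^{-π|y|/2}` — the case `n = 0` of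
`GammaVert.norm_Gamma_half_add_nat_add_mul_I_ge` (deprecated; use that theorem). [folklore] -/
@[deprecated Literature.Analysis.SpecialFunctions.GammaVert.norm_Gamma_half_add_nat_add_mul_I_ge
  (since := "2026-08-17")]
theorem norm_Gamma_half_add_mul_I_ge (y : ℝ) :
    Real.sqrt Real.pi * Real.exp (-(Real.pi / 2) * |y|) ≤ ‖Complex.Gamma (1 / 2 + y * I)‖ := by
  simpa using
    Literature.Analysis.SpecialFunctions.GammaVert.norm_Gamma_half_add_nat_add_mul_I_ge 0 y

/-- **DISCHARGE of `Literature.Uncategorized.GammaLowerBound`**: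
`|Γ(1/2 + n + iy)| ≥ √π e^{-π|y|/2} 2^{-n}` for all `n : ℕ`, `y : ℝ` — verbatim the theorem
`GammaVert.norm_Gamma_half_add_nat_add_mul_I_ge` of
`Literature/Analysis/SpecialFunctions/GammaVerticalLowerBound.lean`. [folklore] -/
theorem GammaLowerBound_holds : GammaLowerBound :=
  Literature.Analysis.SpecialFunctions.GammaVert.norm_Gamma_half_add_nat_add_mul_I_ge

end Literature.Uncategorized

end
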